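import Summits.ABC.IUTFork.Joshi.ThetaJoshiConstruction
import HarnessLib

/-!
# NON-VACUITY of the §6.3–§6.4 carriers of `Joshi/ThetaJoshiConstruction.lean` (p428539): toy models, kernel-checked

Proof-only companion (abc-iut cell, block E, rung LADDER-ABC:A2.E; seat abc-iut-E-t10). The interim carriers over which [J-III] §6.3–§6.4
were typed — `ATS3.CollationDatum` (Ansatz tuples, valuation scaling, Thm. 6.3.1) and `ATS3.ThetaLiftDatum` (maximal ideals / residue
fields / Teichmüller lifts / Tate-module generator, Def. 6.4.3.1) — are SATISFIABLE, and on the models every claim-def typed there that a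
theorem of p428539 consumes as a hypothesis (`ValuationScaling`, `TeichLiftExists`) or concludes (`Thm631`, `Rmk6422`) HOLDS: so no theorem of
p428539 quantifies over an empty type and no hypothesis set used there is contradictory. TOY models (honest `j²`-scaling on points labelled
by their `|p|`-value; `B = ℤ`, `𝔪 = (p)`, Teichmüller lifts of `{0,1}`): they witness consistency of the SIGNATURE, nothing about Joshi's
objects. No side taken; typed ≠ proved ≠ endorsed.
-/

noncomputable section

namespace Summit.ABC.IUTFork.Joshi.ATS3

namespace Model

/-! ## A `CollationDatum` with honest `j²`-scaling -/

/-- Toy collation datum: `ℓ⋇ = 2`, one place (in `V^{odd,ss}`), a point `y` IS its value `|p|_{K_y} ∈ (0,1)`, and the local Ansatz consists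
of the tuples `(c, c⁴)` — i.e. `|p|_{K_{y_j}} = c^{j²}`, the printed scaling law (Thm. 4.2.2.1 (4)) built in. [folklore] -/
def collation : CollationDatum where
  lstar := 2
  V := Unit
  Voddss := Set.univ
  Y := fun _ => {c : ℝ // 0 < c ∧ c < 1}
  normP := fun _ y => y.val
  normP_pos_lt_one := fun _ y => y.property
  localAnsatz := fun _ => {z | ∃ c : ℝ, 0 < c ∧ ∀ i : Fin 2, (z i).val = c ^ ((i.val + 1) ^ 2)}

/-- The toy datum satisfies the valuation-scaling hypothesis (Thm. 4.2.2.1 (4) as typed). PROVED. [folklore] -/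
theorem collation_valuationScaling : collation.ValuationScaling := by
  intro z hz w _
  obtain ⟨c, hc0, hc⟩ := hz.1 w (Set.mem_univ w)
  exact ⟨c, hc0, fun i => hc i⟩

/-- `V^{odd,ss}` of the toy datum is inhabited. [folklore] -/
theorem collation_voddss_nonempty : collation.Voddss.Nonempty := ⟨(), Set.mem_univ _⟩

/-- Hence Thm. 6.3.1 HOLDS on the toy datum (via p428539's `thm631_of_valuationScaling`). PROVED. [folklore] -/
theorem collation_thm631 : collation.Thm631 :=
  collation.thm631_of_valuationScaling collation_valuationScaling collation_voddss_nonempty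

/-- `(1/2)^n ∈ (0,1)` for `n ≥ 1`. [folklore] -/
theorem half_pow_mem (n : ℕ) (hn : n ≠ 0) : 0 < (1 / 2 : ℝ) ^ n ∧ (1 / 2 : ℝ) ^ n < 1 :=
  ⟨by positivity, pow_lt_one₀ (by norm_num) (by norm_num) hn⟩

/-- The toy Ansatz is inhabited: the tuple `(1/2, (1/2)⁴)` is an Ansatz point (a «Θ_gau-link» of the toy). PROVED. [folklore] -/
theorem collation_ansatz_nonempty : collation.adelicAnsatz.Nonempty := by
  refine ⟨fun i _ => ⟨(1 / 2 : ℝ) ^ ((i.val + 1) ^ 2), half_pow_mem _ (by positivity)⟩, fun w _ => ?_, fun w hw => absurd (Set.mem_univ w) hw⟩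
  exact ⟨1 / 2, by norm_num, fun i => rfl⟩

/-! ## A `ThetaLiftDatum` over `B = ℤ`, `𝔪 = (p)` -/

variable (p : ℕ) [hp : Fact p.Prime]

/-- `(p) ⊂ ℤ` is maximal. [folklore] -/
theorem span_isMaximal : (Ideal.span {(p : ℤ)}).IsMaximal :=
  ((Ideal.span_singleton_prime (by exact_mod_cast hp.out.ne_zero)).2 (Nat.prime_iff_prime_int.1 hp.out)).isMaximal
    (by rw [Ne, Ideal.span_singleton_eq_bot]; exact_mod_cast hp.out.ne_zero)

/-- `1 ≠ 0` in `ℤ/(p)`. [folklore] -/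
theorem mk_one_ne_zero : Ideal.Quotient.mk (Ideal.span {(p : ℤ)}) 1 ≠ 0 := by
  rw [Ne, Ideal.Quotient.eq_zero_iff_mem]
  exact fun h => (span_isMaximal p).ne_top ((Ideal.eq_top_iff_one _).2 h)

open Classical in
/-- Toy lift datum: `O_E = B = ℤ`, one point with maximal ideal `(p)`, tilt `{0, 1}` (as `Bool`) with Teichmüller lifts `0, 1`, norms
`|x|`, residue absolute value trivial (`0 ↦ 0`, else `1`), theta value and Tate parameter `1 mod p`, Tate-module generator `p ∈ (p)`.
[folklore] -/
def lift : ThetaLiftDatum ℤ ℤ Unit where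
  m := fun _ => Ideal.span {(p : ℤ)}
  m_isMaximal := fun _ => span_isMaximal p
  Cflat := Bool
  teich := fun b => if b then 1 else 0
  absFlat := fun b => if b then 1 else 0
  norm := fun _ x => |(x : ℝ)|
  norm_teich := fun _ _ _ b => by cases b <;> simp
  absK := fun _ x => if x = 0 then 0 else 1
  absK_teich := fun _ b => by
    cases b
    · simp
    · simp only [if_true, if_neg (mk_one_ne_zero p)]
  xi := fun _ => 1
  tate := fun _ => 1
  tgen := fun _ => (p : ℤ)
  tgen_mem := fun _ => Ideal.subset_span rfl

/-- `[1]` is a Teichmüller lift of the toy theta value `1`. PROVED. [folklore] -/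
theorem lift_isTeichLift : (lift p).IsTeichLift () true := by
  change Ideal.Quotient.mk (Ideal.span {(p : ℤ)}) (if true then (1 : ℤ) else 0) = 1
  simp

/-- `TeichLiftExists` ([J-IIp] Thm. 8.1.1 as typed) HOLDS on the toy datum. PROVED. [folklore] -/
theorem lift_teichLiftExists : (lift p).TeichLiftExists :=
  (lift p).teichLiftExists_iff.2 fun _ => ⟨true, lift_isTeichLift p⟩

/-- Rmk. 6.4.2.2 HOLDS on the toy datum (it holds on every datum: p428539 `rmk6422_holds`). [folklore] -/
theorem lift_rmk6422 : (lift p).Rmk6422 := (lift p).rmk6422_holds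

/-- Admissible lifts (Def. 6.4.3.1) over a toy Ansatz tuple exist. PROVED. [folklore] -/
theorem lift_admissibleLifts_nonempty :
    ((lift p).admissibleLifts (Set.univ : Set (Fin 2 → Unit)) (fun _ => ())).Nonempty :=
  (lift p).admissibleLifts_nonempty_of_teichLiftExists (lift_teichLiftExists p) (Set.mem_univ _)

end Model

end Summit.ABC.IUTFork.Joshi.ATS3

end
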